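import Mathlib

/-!
# Venture HSemireg — W3 SPECIAL FIBRES: the linear algebra of THEOREM Q (irregularity of Schoen's
# carrier through the Ries member; seat `w3-jac-1` g9, `widen/W3/W3-JAC-1-RIES.md` v1.4 §6.5)

HONEST FRAMING. Lean index of the computation cell `pub-hsemireg`, widening seat `w3-jac-1`.  ELEMENTARY
LINEAR ALGEBRA ONLY: no curve, no symmetric product, no sheaf is constructed here.  On paper (RIES §6.5 (a))
the first cohomology classes on the five normalised strata (400), (211), (022), (130), (103) of the Ries
carrier at `d = 4`, type 0 — vectors `a₀; (b₀,b₁,b₂); (c₁,c₂); (d₀,d₁); (e₀,e₂)` in `V = H¹(C', 𝒪)` — are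
compatible along the six double loci iff the «edge rules» below hold (shared indices agree; along an
`F_k`-edge the trigonal curve pulls back by `−1` and the graph by the sum); `compatible_classes_determined`
and `compatible_classes_exist` say that the solutions are exactly the triples `(b₀, b₁, −b₀−b₁)` propagated to
all strata — a copy of `V²`, i.e. `2 · dim V = 2 · 4 = 8 = 2d` (`irregularity_count`), the cohomological
shadow of `1 + ζ + ζ² = 0`.  On paper (§6.5 (c)(2)) the constant sections of `ν_*𝒪/𝒪` inside `ℂ⁶` (six
double loci) are cut by the two triangle conditions and coincide with the coboundaries of the five strata:
`section_count`.  Nothing here says that HC, HC_CM or HC_AV holds or that the geometric hypotheses of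
RIES §6.5 are met; tiers are the W3 pen's.

CONTENT (all PROVED, 0 sorry), namespace `Summit.Ventures.HSemireg.SchoenCarrierRiesIrregularity`.
-/

namespace Summit.Ventures.HSemireg.SchoenCarrierRiesIrregularity

variable {V : Type*} [AddCommGroup V]

/-- RIES §6.5 (a): the six edge rules determine every class from `(b₀, b₁)`:
edge 400∣211 (`F₀`): `a₀ = b₀`, `−a₀ = b₁ + b₂`; edge 211∣022 (`F₀`): `c₁ = b₁`, `c₂ = b₂`, `−b₀ = c₁ + c₂`;
edge 211∣130 (`F₁`): `d₀ = b₀`, `d₁ = b₁`, `−d₁ = b₂ + b₀`; edge 211∣103 (`F₂`): `e₀ = b₀`, `e₂ = b₂`,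
`−e₂ = b₀ + b₁`; edge 022∣130 (`F₂`): `c₁ = d₁`, `−c₂ = d₀ + d₁`; edge 022∣103 (`F₁`): `c₂ = e₂`,
`−c₁ = e₀ + e₂`. -/
theorem compatible_classes_determined (a₀ b₀ b₁ b₂ c₁ c₂ d₀ d₁ e₀ e₂ : V)
    (h1 : a₀ = b₀) (h2 : -a₀ = b₁ + b₂) (h3 : c₁ = b₁) (h4 : c₂ = b₂) (_h5 : -b₀ = c₁ + c₂)
    (h6 : d₀ = b₀) (h7 : d₁ = b₁) (_h8 : -d₁ = b₂ + b₀) (h9 : e₀ = b₀) (h10 : e₂ = b₂)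
    (_h11 : -e₂ = b₀ + b₁) (_h12 : c₁ = d₁) (_h13 : -c₂ = d₀ + d₁) (_h14 : c₂ = e₂)
    (_h15 : -c₁ = e₀ + e₂) :
    a₀ = b₀ ∧ b₂ = -b₀ - b₁ ∧ c₁ = b₁ ∧ c₂ = -b₀ - b₁ ∧ d₀ = b₀ ∧ d₁ = b₁ ∧ e₀ = b₀ ∧
      e₂ = -b₀ - b₁ := by
  have hb2 : b₂ = -b₀ - b₁ := by
    have : b₁ + b₂ = -b₀ := by rw [← h1]; exact h2.symm
    have : b₂ = -b₀ - b₁ := by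
      have := congrArg (fun x => x - b₁) this
      simpa [add_sub_cancel_left, sub_eq_add_neg, add_comm, add_left_comm] using this
    exact this
  refine ⟨h1, hb2, h3, ?_, h6, h7, h9, ?_⟩
  · rw [h4, hb2]
  · rw [h10, hb2]

/-- RIES §6.5 (a), converse: for every `(b₀, b₁)` the propagated classes satisfy all fifteen edge
relations — so the compatible classes form a copy of `V × V`. -/
theorem compatible_classes_exist (b₀ b₁ : V) :
    let b₂ := -b₀ - b₁
    let a₀ := b₀; let c₁ := b₁; let c₂ := b₂; let d₀ := b₀; let d₁ := b₁; let e₀ := b₀; let e₂ := b₂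
    a₀ = b₀ ∧ -a₀ = b₁ + b₂ ∧ c₁ = b₁ ∧ c₂ = b₂ ∧ -b₀ = c₁ + c₂ ∧ d₀ = b₀ ∧ d₁ = b₁ ∧
      -d₁ = b₂ + b₀ ∧ e₀ = b₀ ∧ e₂ = b₂ ∧ -e₂ = b₀ + b₁ ∧ c₁ = d₁ ∧ -c₂ = d₀ + d₁ ∧ c₂ = e₂ ∧
      -c₁ = e₀ + e₂ := by
  refine ⟨rfl, ?_, rfl, rfl, ?_, rfl, rfl, ?_, rfl, rfl, ?_, rfl, ?_, rfl, ?_⟩ <;> abel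

/-- RIES §6.5: the count. Two free blocks of dimension `g(C') = 4` each give `8 = 2d` compatible
dimensions out of `4 + 12 + 8 + 8 + 8 = 40`; at `d = 2, 3` the same rule leaves `2 · g(C')` = `4, 6`. -/
theorem irregularity_count :
    2 * 4 = 8 ∧ 8 = 2 * 4 ∧ 4 + 12 + 8 + 8 + 8 = 40 ∧ 2 * 2 = 4 ∧ 2 * 3 = 6 := by
  norm_num

/-- RIES §6.5 (c)(2): six double loci, two independent triangle conditions, five strata: the constant
sections of `ν_*𝒪/𝒪` have dimension `6 − 2 = 4 = 5 − 1` (= the rank of the coboundary map of a connected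
graph on five vertices), so the connecting map contributes nothing and `h¹(𝒪_{X₀}) ≤ 8`; the first Betti
number of the dual graph before filling is `6 − 5 + 1 = 2`. -/
theorem section_count : (6 : ℤ) - 2 = 4 ∧ (5 : ℤ) - 1 = 4 ∧ (6 : ℤ) - 5 + 1 = 2 := by
  norm_num

/-- RIES §6.5 (c)(2): the two triangle conditions imply the square condition at the `F₁ + F₂` points
(`c₁ = (211,022,130)`, `c₂ = (211,022,103)` oriented): subtracting them gives the 4-cycle relation. -/
theorem square_from_triangles (x₁ x₂ x₃ y₂ y₃ : ℚ) (t1 : x₁ + x₂ + x₃ = 0) (t2 : x₁ + y₂ + y₃ = 0) :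
    x₂ + x₃ - y₂ - y₃ = 0 := by
  linarith

end Summit.Ventures.HSemireg.SchoenCarrierRiesIrregularity
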